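import Summits.QuantumFields.YangMills.Theorems.FluctuationComparisonRegPrIntLOrganTangentOneBondAtDescend
import Summits.QuantumFields.YangMills.Theorems.FluctuationComparisonRegPrIntLOneBondLocalInverse
import Literature.MathematicalPhysics.QuantumFieldTheory.Balaban1983to89.BlockAveragingExpMeanLogContinuous
import Literature.MathematicalPhysics.QuantumFieldTheory.Balaban1983to89.BlockAveragingCentralBlind
import HarnessLib

/-!
# `FluctuationComparisonRegPrIntLOrganTangentOneBondData` — (L6b) THE PER-BOND DATA `T T′ θ` OF THE TRIANGULAR CHART AT `descend`, CONSTRUCTED FROM STAGE 1: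
# open target sets (sectionwise and jointly), two radii, the right inverse at `update U (β c) (θ c U v)`, joint continuity (REG), the field's own coordinate (SOL), the margin

Cell `ym3-torus` (rung R3 = continuum `SU(2)` Yang–Mills on T³ — NOT d = 4, NOT infinite volume, NOT a mass gap, NOT Clay), width seat `ym-ust-20520-w5` (gen 21), pen (L6b)
(LEAD-20520 w3 g22 «(L6) YOURS — GO»; binders keyed to ✓`…OrganTangentTriangularChart.regularPackage_of_oneVariableInverseLaws` ((L5) v2) and ✓`…mass_of_smallLift`).
`--kind proof --supports stmt-QuantumFields-20520 --as helper`, count-neutral, definition-free; THEOREMS ONLY; nothing printed is asserted.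

★ `oneBondData`: for `F, j`, a centre index `i₀` off-central at every bond (`hi₀`; e.g. any index with two nonzero transverse offsets), radii `s, ρ, d₀`, a target radius
`0 < ρ″ ≤ ρ′_c := ρ − ((m_c∕|ι|)(s+ρ) + 36(s+ρ)²)` for every bond (`m_c` = the off-central count at `ĉ`; satisfiable since `m_c < |ι|`), a smallness `a` with
`t := ((d+2)L)²∕4 · a`, under the NUMERIC side conditions `s + ρ + d₀ ≤ 1∕24`, `< δ₂`, `m_c∕|ι| + 144 (s + ρ + d₀) < 1` (every `c`), `t < δ₂`, `2t < s`, `t ≤ ρ`, `7t < ρ″∕2`: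
THERE ARE `T T′ : PBond → T_{j+1} → Set SU(2)` and `θ : PBond → T_{j+1} → SU(2) → SU(2)` —
`T c U := {v | (∀ off-central i, ‖openHol U ĉ i − openHol U ĉ i₀‖ < s) ∧ ‖v − openHol U ĉ i₀‖ < ρ″}`, `T′` the same with `ρ″∕2`,
`θ c U v := (pre U ĉ)⁻¹ · θ°_c (openHol U ĉ) v · (post U ĉ)⁻¹` ON `T c U` and `1` off it (`θ°_c` = ✓`continuousOn_oneBond_localInverse_family` at `p := IsCentral ĉ`) — with:
(hTo) `T c U` open for every `U` AND `{p | p.2 ∈ T c p.1}` open; (hT′T) `closure (T′ c U) ⊆ T c U`; (hright) `descend F ℰp j (update U (β c) (θ c U v)) c = v` on `T c U`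
(✓`descend_update_private_eq` + Stage 1 ★★); (REG) `ContinuousOn (fun p => θ c p.1 p.2) {p | p.2 ∈ T c p.1}` and sectionwise `ContinuousOn (θ c U) (T c U)`
(Stage 1 ★★★ + ✓`continuous_holAt`); (SOL) `PlaqSmall a U → descend U c ∈ T′ c U ∧ θ c U (descend U c) = U (β c)` (✓`descend_eq_avg_mul_axialAvg` + Stage 1 ★
uniqueness + ✓`small_is_good`); (hmargin) `(∀ c, V c ∈ T c U) → PlaqSmall a (extend β (θ · U (V ·)) U) → ∀ c, V c ∈ T′ c U` (✓`apply_triChart_eq_of_forall_mem` +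
✓`openHol_congr_off_private` + ✓`small_is_good`); (hTm), (hT′m) `{p | p.2 ∈ T c p.1}`, `{p | p.2 ∈ T′ c p.1}` measurable (open); (hθm) `θ c` JOINTLY MEASURABLE
(Mathlib `ContinuousOn.measurable_piecewise`: continuous on the open good set, constant off it); and, FOR STAGE 2: ⑫ BLINDNESS — if `U′` agrees with `U` off the
private bonds of all coarse bonds then `T c U′ = T c U`, `T′ c U′ = T′ c U`, `θ c U′ = θ c U` (lit ✓`BlockAveragingCentralBlind.apply_extend_eq_of_forall_update`,
`pre∕post_update_centralBond_any`, ✓`openHol_congr_off_private`; the Stage-1 preimage does not read the central entries of the environment, by uniqueness);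
⑬ WINDOW — for `v ∈ T c U` the argument `pre·θ c U v·post` is within `ρ` of `openHol U ĉ i₀` and within `s+ρ+d₀` of every off-central `openHol U ĉ i`
(so `θ(T)` sits in the central `(s+ρ+d₀)`-window of pub-ymgap's N09 forward law); ⑭ LEFT INVERSE — for `g` with `pre·g·post` within `ρ` of the centre and
`descend F ℰp j (update U (β c) g) c ∈ T c U`: `θ c U (descend F ℰp j (update U (β c) g) c) = g` (Stage 1 ★ uniqueness).
After this file the (L5) v2 ∕ `mass_of_smallLift` display keeps, on the chart side, ONLY {`Ω`, `jac`, `hlaw`, `hjc`, `hjM`, `hjpos`, `hjm`, `hΩm`, `hΩbl`, `hΩS` — the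
Stage-2 LAW, a COMPOSITION of ⑫–⑭ with ✓`BalabanUVNodes.N09CentralWindowForwardLawAtRecord.exists_jacobian_forwardLaws_continuousOn` and lit
✓`T4TriangularFibredChart.restrict_eq_map_withDensity_of_leftInvOn` —, and (LIFT) ⟸ (B4)}.
NOT HERE: the inverse LAW, (C3); nothing of VER∘∕(A)∕COAREA∘∕O1∕20520∕`YM3TorusSU2` is proved.  No `def`, `instance`, `notation`, `sorry`.
-/

set_option autoImplicit false

noncomputable section

namespace Summit.QuantumFields.YangMills.Theorems.FluctuationComparisonRegPrIntLOrganTangentOneBondData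

open Set Function Filter Topology MeasureTheory
open Literature.MathematicalPhysics.QuantumFieldTheory.Balaban1983to89
open Literature.MathematicalPhysics.QuantumFieldTheory.Balaban1983to89.T3OrbitAverage
open T3ContinuumYM3Torus T3NestedUnitLaws T3UnitLawDensityEML T3LevelShift T4Continuum AveragingRT BlockAveraging
open Literature.MathematicalPhysics.QuantumFieldTheory.Balaban1983to89.BlockAveragingHaarAC
  (centralBond openHol IsCentral pre post axialAvg_eq_pre_mul_mul_post)
open Literature.MathematicalPhysics.QuantumFieldTheory.Balaban1983to89.T4TriangularPushforward (IsLocal)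
open ExpMeanLog (expMeanLogSU deltaSU)
open Summit.QuantumFields.YangMills.Theorems.OrganTangentTriangularChart (isLocal_descend injective_private)
open Summit.QuantumFields.YangMills.Theorems.FluctuationComparisonRegPrIntLOneBondLocalInverse (continuousOn_oneBond_localInverse_family)
open Summit.QuantumFields.YangMills.Theorems.FluctuationComparisonRegPrIntLOrganTangentOneBondAtDescend
  (level_ok descend_update_private_eq descend_eq_avg_mul_axialAvg openHol_congr_off_private small_is_good)
open scoped Matrix.Norms.L2Operator

/-! ## §1 Generic pieces: continuity of the transporters, the target sets -/

/-- Holonomies along fixed walks are continuous in the configuration: `openHol · b i`, `pre · b`, `post · b`. [folklore] -/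
theorem continuous_openHol_pre_post {P : Params} {k : ℕ} (b : PBond P (k + 1)) (i : Idx P) :
    Continuous (fun U : GaugeField P k ↥(Matrix.specialUnitaryGroup (Fin 2) ℂ) => openHol U b i) ∧
      Continuous (fun U : GaugeField P k ↥(Matrix.specialUnitaryGroup (Fin 2) ℂ) => pre U b) ∧
      Continuous (fun U : GaugeField P k ↥(Matrix.specialUnitaryGroup (Fin 2) ℂ) => post U b) := by
  unfold openHol pre post; exact ⟨continuous_holAt (n := Fin 2) _, continuous_holAt (n := Fin 2) _, continuous_holAt (n := Fin 2) _⟩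

/-- The target set `{v | GOOD_s(U, b) ∧ ‖v − openHol U b i₀‖ < r}` is open (an open ball or empty). [folklore] -/
theorem isOpen_goodBall {P : Params} {k : ℕ} (b : PBond P (k + 1)) (i₀ : Idx P) (s r : ℝ) (U : GaugeField P k ↥(Matrix.specialUnitaryGroup (Fin 2) ℂ)) :
    IsOpen {v : ↥(Matrix.specialUnitaryGroup (Fin 2) ℂ) | (∀ i, ¬ IsCentral b i →
        ‖((openHol U b i : ↥(Matrix.specialUnitaryGroup (Fin 2) ℂ)) : Matrix (Fin 2) (Fin 2) ℂ) -
          ((openHol U b i₀ : ↥(Matrix.specialUnitaryGroup (Fin 2) ℂ)) : Matrix (Fin 2) (Fin 2) ℂ)‖ < s) ∧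
      ‖((v : ↥(Matrix.specialUnitaryGroup (Fin 2) ℂ)) : Matrix (Fin 2) (Fin 2) ℂ) -
        ((openHol U b i₀ : ↥(Matrix.specialUnitaryGroup (Fin 2) ℂ)) : Matrix (Fin 2) (Fin 2) ℂ)‖ < r} := by
  have hc : Continuous fun w : ↥(Matrix.specialUnitaryGroup (Fin 2) ℂ) => ‖((w : ↥(Matrix.specialUnitaryGroup (Fin 2) ℂ)) : Matrix (Fin 2) (Fin 2) ℂ) -
      ((openHol U b i₀ : ↥(Matrix.specialUnitaryGroup (Fin 2) ℂ)) : Matrix (Fin 2) (Fin 2) ℂ)‖ := (continuous_subtype_val.sub continuous_const).norm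
  simp only [Set.setOf_and]
  exact (isOpen_const).inter (isOpen_lt hc continuous_const)

/-- … and JOINTLY open in `(U, v)`. [folklore] -/
theorem isOpen_goodBall_joint {P : Params} {k : ℕ} (b : PBond P (k + 1)) (i₀ : Idx P) (s r : ℝ) :
    IsOpen {p : GaugeField P k ↥(Matrix.specialUnitaryGroup (Fin 2) ℂ) × ↥(Matrix.specialUnitaryGroup (Fin 2) ℂ) | (∀ i, ¬ IsCentral b i →
        ‖((openHol p.1 b i : ↥(Matrix.specialUnitaryGroup (Fin 2) ℂ)) : Matrix (Fin 2) (Fin 2) ℂ) -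
          ((openHol p.1 b i₀ : ↥(Matrix.specialUnitaryGroup (Fin 2) ℂ)) : Matrix (Fin 2) (Fin 2) ℂ)‖ < s) ∧
      ‖((p.2 : ↥(Matrix.specialUnitaryGroup (Fin 2) ℂ)) : Matrix (Fin 2) (Fin 2) ℂ) -
        ((openHol p.1 b i₀ : ↥(Matrix.specialUnitaryGroup (Fin 2) ℂ)) : Matrix (Fin 2) (Fin 2) ℂ)‖ < r} := by
  have hV : ∀ i, Continuous fun p : GaugeField P k ↥(Matrix.specialUnitaryGroup (Fin 2) ℂ) × ↥(Matrix.specialUnitaryGroup (Fin 2) ℂ) =>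
      ((openHol p.1 b i : ↥(Matrix.specialUnitaryGroup (Fin 2) ℂ)) : Matrix (Fin 2) (Fin 2) ℂ) :=
    fun i => continuous_subtype_val.comp ((continuous_openHol_pre_post b i).1.comp continuous_fst)
  simp only [Set.setOf_and, Set.setOf_forall]
  have hb : Continuous fun p : GaugeField P k ↥(Matrix.specialUnitaryGroup (Fin 2) ℂ) × ↥(Matrix.specialUnitaryGroup (Fin 2) ℂ) =>
      ‖((p.2 : ↥(Matrix.specialUnitaryGroup (Fin 2) ℂ)) : Matrix (Fin 2) (Fin 2) ℂ) -
        ((openHol p.1 b i₀ : ↥(Matrix.specialUnitaryGroup (Fin 2) ℂ)) : Matrix (Fin 2) (Fin 2) ℂ)‖ :=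
    ((continuous_subtype_val.comp continuous_snd).sub (hV i₀)).norm
  refine IsOpen.inter (isOpen_iInter_of_finite fun i => ?_) (isOpen_lt hb continuous_const)
  have hc : Continuous fun p : GaugeField P k ↥(Matrix.specialUnitaryGroup (Fin 2) ℂ) × ↥(Matrix.specialUnitaryGroup (Fin 2) ℂ) =>
      ‖((openHol p.1 b i : ↥(Matrix.specialUnitaryGroup (Fin 2) ℂ)) : Matrix (Fin 2) (Fin 2) ℂ) -
        ((openHol p.1 b i₀ : ↥(Matrix.specialUnitaryGroup (Fin 2) ℂ)) : Matrix (Fin 2) (Fin 2) ℂ)‖ := ((hV i).sub (hV i₀)).norm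
  by_cases hi : IsCentral b i
  · simp only [hi, not_true_eq_false, Set.iInter_of_empty, isOpen_univ]
  · simp only [hi, not_false_eq_true, Set.iInter_true]
    exact isOpen_lt hc continuous_const

/-- The closure of the half-radius target set lies in the full one (`0 < r`). [folklore] -/
theorem closure_goodBall_half_subset {P : Params} {k : ℕ} (b : PBond P (k + 1)) (i₀ : Idx P) (s : ℝ) {r : ℝ} (hr : 0 < r)
    (U : GaugeField P k ↥(Matrix.specialUnitaryGroup (Fin 2) ℂ)) :
    closure {v : ↥(Matrix.specialUnitaryGroup (Fin 2) ℂ) | (∀ i, ¬ IsCentral b i →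
        ‖((openHol U b i : ↥(Matrix.specialUnitaryGroup (Fin 2) ℂ)) : Matrix (Fin 2) (Fin 2) ℂ) -
          ((openHol U b i₀ : ↥(Matrix.specialUnitaryGroup (Fin 2) ℂ)) : Matrix (Fin 2) (Fin 2) ℂ)‖ < s) ∧
      ‖((v : ↥(Matrix.specialUnitaryGroup (Fin 2) ℂ)) : Matrix (Fin 2) (Fin 2) ℂ) -
        ((openHol U b i₀ : ↥(Matrix.specialUnitaryGroup (Fin 2) ℂ)) : Matrix (Fin 2) (Fin 2) ℂ)‖ < r / 2} ⊆
    {v : ↥(Matrix.specialUnitaryGroup (Fin 2) ℂ) | (∀ i, ¬ IsCentral b i →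
        ‖((openHol U b i : ↥(Matrix.specialUnitaryGroup (Fin 2) ℂ)) : Matrix (Fin 2) (Fin 2) ℂ) -
          ((openHol U b i₀ : ↥(Matrix.specialUnitaryGroup (Fin 2) ℂ)) : Matrix (Fin 2) (Fin 2) ℂ)‖ < s) ∧
      ‖((v : ↥(Matrix.specialUnitaryGroup (Fin 2) ℂ)) : Matrix (Fin 2) (Fin 2) ℂ) -
        ((openHol U b i₀ : ↥(Matrix.specialUnitaryGroup (Fin 2) ℂ)) : Matrix (Fin 2) (Fin 2) ℂ)‖ < r} := by
  by_cases hg : ∀ i, ¬ IsCentral b i →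
      ‖((openHol U b i : ↥(Matrix.specialUnitaryGroup (Fin 2) ℂ)) : Matrix (Fin 2) (Fin 2) ℂ) -
        ((openHol U b i₀ : ↥(Matrix.specialUnitaryGroup (Fin 2) ℂ)) : Matrix (Fin 2) (Fin 2) ℂ)‖ < s
  · intro v hv
    refine ⟨hg, ?_⟩
    have hcl : v ∈ closure {w : ↥(Matrix.specialUnitaryGroup (Fin 2) ℂ) |
        ‖((w : ↥(Matrix.specialUnitaryGroup (Fin 2) ℂ)) : Matrix (Fin 2) (Fin 2) ℂ) -
          ((openHol U b i₀ : ↥(Matrix.specialUnitaryGroup (Fin 2) ℂ)) : Matrix (Fin 2) (Fin 2) ℂ)‖ ≤ r / 2} :=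
      closure_mono (fun w hw => hw.2.le) hv
    have hc : Continuous fun w : ↥(Matrix.specialUnitaryGroup (Fin 2) ℂ) => ‖((w : ↥(Matrix.specialUnitaryGroup (Fin 2) ℂ)) : Matrix (Fin 2) (Fin 2) ℂ) -
        ((openHol U b i₀ : ↥(Matrix.specialUnitaryGroup (Fin 2) ℂ)) : Matrix (Fin 2) (Fin 2) ℂ)‖ := (continuous_subtype_val.sub continuous_const).norm
    rw [(isClosed_le hc continuous_const).closure_eq] at hcl
    have : ‖((v : ↥(Matrix.specialUnitaryGroup (Fin 2) ℂ)) : Matrix (Fin 2) (Fin 2) ℂ) -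
        ((openHol U b i₀ : ↥(Matrix.specialUnitaryGroup (Fin 2) ℂ)) : Matrix (Fin 2) (Fin 2) ℂ)‖ ≤ r / 2 := hcl
    show _ < r; linarith
  · have : {v : ↥(Matrix.specialUnitaryGroup (Fin 2) ℂ) | (∀ i, ¬ IsCentral b i →
        ‖((openHol U b i : ↥(Matrix.specialUnitaryGroup (Fin 2) ℂ)) : Matrix (Fin 2) (Fin 2) ℂ) -
          ((openHol U b i₀ : ↥(Matrix.specialUnitaryGroup (Fin 2) ℂ)) : Matrix (Fin 2) (Fin 2) ℂ)‖ < s) ∧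
        ‖((v : ↥(Matrix.specialUnitaryGroup (Fin 2) ℂ)) : Matrix (Fin 2) (Fin 2) ℂ) -
          ((openHol U b i₀ : ↥(Matrix.specialUnitaryGroup (Fin 2) ℂ)) : Matrix (Fin 2) (Fin 2) ℂ)‖ < r / 2} = ∅ := by
      ext v; simp only [Set.mem_setOf_eq, Set.mem_empty_iff_false, iff_false, not_and]; exact fun h => absurd h hg
    rw [this, closure_empty]; exact Set.empty_subset _

/-- The family-ball estimate behind (hright): a good environment and a preimage within `ρ` of the centre put every off-central `V i` within `s + ρ + d₀` of it. [folklore] -/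
theorem fam_of_good_of_ball {ι : Type*} (p : ι → Prop) (V : ι → Matrix (Fin 2) (Fin 2) ℂ) (i₀ : ι) (W : Matrix (Fin 2) (Fin 2) ℂ) {s ρ d₀ : ℝ} (hd0 : 0 ≤ d₀)
    (hgood : ∀ i, ¬ p i → ‖V i - V i₀‖ ≤ s) (hW : ‖W - V i₀‖ ≤ ρ) : ∀ i, ¬ p i → ‖V i - W‖ ≤ s + ρ + d₀ := by
  intro i hi
  have h := (norm_add_le _ _).trans (add_le_add (hgood i hi) (by rw [norm_sub_rev]; exact hW : ‖V i₀ - W‖ ≤ ρ))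
  rw [sub_add_sub_cancel] at h; linarith

/-! ## §2 The package -/

-- HEARTBEAT BUDGET (cell README owner rule; px12 g19 19:17:43Z twin: the proof elaborates at ≈ 170–180k of the 200k default — a cliff, not an error):
-- decl-local, line-neutral head-room; no statement depends on it.
set_option maxHeartbeats 400000 in
/-- ★ **THE PER-BOND DATA OF THE TRIANGULAR CHART AT `descend`, FROM STAGE 1** (see the module docstring for the shape of `T T′ θ` and the side conditions;
clauses ⑨–⑪ are the measurability of `T`, `T′` (jointly) and of `θ` (jointly), `θ` being set to `1` off `T`; ⑫–⑭ are blindness, window, left inverse).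
[cite: Balaban1987RG1, (0.4) p.253, (2.4) p.266 and (2.10) p.267] -/
theorem oneBondData (F : T3Family) (j : ℕ) (i₀ : Idx (F.P (j + 1)))
    (hi₀ : ∀ c : PBond (F.P j) 0, ¬ IsCentral (bondShift (sitesPerDir_descend F j 0) c) i₀) {s ρ d₀ ρ'' a : ℝ}
    (hs0 : 0 < s) (hρ0 : 0 ≤ ρ) (hd0 : 0 < d₀) (hr : s + ρ + d₀ ≤ 1 / 24) (hrδ : s + ρ + d₀ < deltaSU (Fin 2))
    (hq : ∀ c : PBond (F.P j) 0, ((Finset.univ.filter fun i => ¬ IsCentral (bondShift (sitesPerDir_descend F j 0) c) i).card : ℝ) /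
        (Fintype.card (Idx (F.P (j + 1))) : ℝ) + 144 * (s + ρ + d₀) < 1)
    (hρ'' : 0 < ρ'') (hρ''le : ∀ c : PBond (F.P j) 0, ρ'' ≤ ρ - (((Finset.univ.filter fun i => ¬ IsCentral (bondShift (sitesPerDir_descend F j 0) c) i).card : ℝ) /
        (Fintype.card (Idx (F.P (j + 1))) : ℝ) * (s + ρ) + 36 * (s + ρ) ^ 2))
    (ha : 0 ≤ a) (hta : (((((F.P (j + 1)).d + 2) * (F.P (j + 1)).L : ℕ) : ℝ) ^ 2 / 4) * a < deltaSU (Fin 2))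
    (h2t : 2 * ((((((F.P (j + 1)).d + 2) * (F.P (j + 1)).L : ℕ) : ℝ) ^ 2 / 4) * a) < s)
    (htρ : (((((F.P (j + 1)).d + 2) * (F.P (j + 1)).L : ℕ) : ℝ) ^ 2 / 4) * a ≤ ρ)
    (h7t : 7 * ((((((F.P (j + 1)).d + 2) * (F.P (j + 1)).L : ℕ) : ℝ) ^ 2 / 4) * a) < ρ'' / 2) :
    ∃ (T T' : PBond (F.P j) 0 → GaugeField (F.P (j + 1)) 0 ↥(Matrix.specialUnitaryGroup (Fin 2) ℂ) → Set ↥(Matrix.specialUnitaryGroup (Fin 2) ℂ))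
      (θ : PBond (F.P j) 0 → GaugeField (F.P (j + 1)) 0 ↥(Matrix.specialUnitaryGroup (Fin 2) ℂ) → ↥(Matrix.specialUnitaryGroup (Fin 2) ℂ) → ↥(Matrix.specialUnitaryGroup (Fin 2) ℂ)),
      (∀ c U, IsOpen (T c U)) ∧
      (∀ c, IsOpen {p : GaugeField (F.P (j + 1)) 0 ↥(Matrix.specialUnitaryGroup (Fin 2) ℂ) × ↥(Matrix.specialUnitaryGroup (Fin 2) ℂ) | p.2 ∈ T c p.1}) ∧
      (∀ c U, closure (T' c U) ⊆ T c U) ∧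
      (∀ c U, ∀ v ∈ T c U, descend F ℰp j (update U (centralBond (bondShift (sitesPerDir_descend F j 0) c)) (θ c U v)) c = v) ∧
      (∀ c, ContinuousOn (fun p : GaugeField (F.P (j + 1)) 0 ↥(Matrix.specialUnitaryGroup (Fin 2) ℂ) × ↥(Matrix.specialUnitaryGroup (Fin 2) ℂ) => θ c p.1 p.2) {p | p.2 ∈ T c p.1}) ∧
      (∀ c U, ContinuousOn (θ c U) (T c U)) ∧
      (∀ U : GaugeField (F.P (j + 1)) 0 ↥(Matrix.specialUnitaryGroup (Fin 2) ℂ), PlaqSmall a U →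
        ∀ c, descend F ℰp j U c ∈ T' c U ∧ θ c U (descend F ℰp j U c) = U (centralBond (bondShift (sitesPerDir_descend F j 0) c))) ∧
      (∀ (U : GaugeField (F.P (j + 1)) 0 ↥(Matrix.specialUnitaryGroup (Fin 2) ℂ)) (V : GaugeField (F.P j) 0 ↥(Matrix.specialUnitaryGroup (Fin 2) ℂ)), (∀ c, V c ∈ T c U) →
        PlaqSmall a (extend (fun c : PBond (F.P j) 0 => centralBond (bondShift (sitesPerDir_descend F j 0) c)) (fun c => θ c U (V c)) U) → ∀ c, V c ∈ T' c U) ∧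
      (∀ c, MeasurableSet {p : GaugeField (F.P (j + 1)) 0 ↥(Matrix.specialUnitaryGroup (Fin 2) ℂ) × ↥(Matrix.specialUnitaryGroup (Fin 2) ℂ) | p.2 ∈ T c p.1}) ∧
      (∀ c, MeasurableSet {p : GaugeField (F.P (j + 1)) 0 ↥(Matrix.specialUnitaryGroup (Fin 2) ℂ) × ↥(Matrix.specialUnitaryGroup (Fin 2) ℂ) | p.2 ∈ T' c p.1}) ∧
      (∀ c, Measurable fun p : GaugeField (F.P (j + 1)) 0 ↥(Matrix.specialUnitaryGroup (Fin 2) ℂ) × ↥(Matrix.specialUnitaryGroup (Fin 2) ℂ) => θ c p.1 p.2) ∧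
      (∀ c (U U' : GaugeField (F.P (j + 1)) 0 ↥(Matrix.specialUnitaryGroup (Fin 2) ℂ)), (∀ b, (¬ ∃ c' : PBond (F.P j) 0, centralBond (bondShift (sitesPerDir_descend F j 0) c') = b) → U' b = U b) →
        T c U' = T c U ∧ T' c U' = T' c U ∧ ∀ v, θ c U' v = θ c U v) ∧
      (∀ c U, ∀ v ∈ T c U,
        ‖((pre U (bondShift (sitesPerDir_descend F j 0) c) * θ c U v * post U (bondShift (sitesPerDir_descend F j 0) c) : ↥(Matrix.specialUnitaryGroup (Fin 2) ℂ)) : Matrix (Fin 2) (Fin 2) ℂ) - ((openHol U (bondShift (sitesPerDir_descend F j 0) c) i₀ : ↥(Matrix.specialUnitaryGroup (Fin 2) ℂ)) : Matrix (Fin 2) (Fin 2) ℂ)‖ ≤ ρ ∧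
        ∀ i, ¬ IsCentral (bondShift (sitesPerDir_descend F j 0) c) i → ‖((openHol U (bondShift (sitesPerDir_descend F j 0) c) i : ↥(Matrix.specialUnitaryGroup (Fin 2) ℂ)) : Matrix (Fin 2) (Fin 2) ℂ) - ((pre U (bondShift (sitesPerDir_descend F j 0) c) * θ c U v * post U (bondShift (sitesPerDir_descend F j 0) c) : ↥(Matrix.specialUnitaryGroup (Fin 2) ℂ)) : Matrix (Fin 2) (Fin 2) ℂ)‖ ≤ s + ρ + d₀) ∧
      (∀ c (U : GaugeField (F.P (j + 1)) 0 ↥(Matrix.specialUnitaryGroup (Fin 2) ℂ)) (g : ↥(Matrix.specialUnitaryGroup (Fin 2) ℂ)), ‖((pre U (bondShift (sitesPerDir_descend F j 0) c) * g * post U (bondShift (sitesPerDir_descend F j 0) c) : ↥(Matrix.specialUnitaryGroup (Fin 2) ℂ)) : Matrix (Fin 2) (Fin 2) ℂ) - ((openHol U (bondShift (sitesPerDir_descend F j 0) c) i₀ : ↥(Matrix.specialUnitaryGroup (Fin 2) ℂ)) : Matrix (Fin 2) (Fin 2) ℂ)‖ ≤ ρ →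
        descend F ℰp j (update U (centralBond (bondShift (sitesPerDir_descend F j 0) c)) g) c ∈ T c U →
        θ c U (descend F ℰp j (update U (centralBond (bondShift (sitesPerDir_descend F j 0) c)) g) c) = g) := by
  classical
  have ht0 : 0 ≤ (((((F.P (j + 1)).d + 2) * (F.P (j + 1)).L : ℕ) : ℝ) ^ 2 / 4) * a := by positivity
  -- Stage 1, per bond: the one-bond local inverse as a map of (environment, target)
  have hstage := fun c : PBond (F.P j) 0 =>
    continuousOn_oneBond_localInverse_family (n := Fin 2) (IsCentral (bondShift (sitesPerDir_descend F j 0) c)) i₀ hs0.le hρ0 hd0 hr hrδ (hq c)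
  choose θ₀ hθ₁ hθ₂ hθ₃ using hstage
  -- the target radius `ρ″` is below every bond's `ρ′`
  have hρ'c := hρ''le
  -- the witnesses, as opaque local functions with defining equations
  obtain ⟨T, hT⟩ : ∃ T : PBond (F.P j) 0 → GaugeField (F.P (j + 1)) 0 ↥(Matrix.specialUnitaryGroup (Fin 2) ℂ) → Set ↥(Matrix.specialUnitaryGroup (Fin 2) ℂ), ∀ c U v, v ∈ T c U ↔ ((∀ i, ¬ IsCentral (bondShift (sitesPerDir_descend F j 0) c) i → ‖((openHol U (bondShift (sitesPerDir_descend F j 0) c) i : ↥(Matrix.specialUnitaryGroup (Fin 2) ℂ)) : Matrix (Fin 2) (Fin 2) ℂ) - ((openHol U (bondShift (sitesPerDir_descend F j 0) c) i₀ : ↥(Matrix.specialUnitaryGroup (Fin 2) ℂ)) : Matrix (Fin 2) (Fin 2) ℂ)‖ < s) ∧ ‖((v : ↥(Matrix.specialUnitaryGroup (Fin 2) ℂ)) : Matrix (Fin 2) (Fin 2) ℂ) - ((openHol U (bondShift (sitesPerDir_descend F j 0) c) i₀ : ↥(Matrix.specialUnitaryGroup (Fin 2) ℂ)) : Matrix (Fin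 2) (Fin 2) ℂ)‖ < ρ'') :=
    ⟨fun c U => {v | (∀ i, ¬ IsCentral (bondShift (sitesPerDir_descend F j 0) c) i → ‖((openHol U (bondShift (sitesPerDir_descend F j 0) c) i : ↥(Matrix.specialUnitaryGroup (Fin 2) ℂ)) : Matrix (Fin 2) (Fin 2) ℂ) - ((openHol U (bondShift (sitesPerDir_descend F j 0) c) i₀ : ↥(Matrix.specialUnitaryGroup (Fin 2) ℂ)) : Matrix (Fin 2) (Fin 2) ℂ)‖ < s) ∧ ‖((v : ↥(Matrix.specialUnitaryGroup (Fin 2) ℂ)) : Matrix (Fin 2) (Fin 2) ℂ) - ((openHol U (bondShift (sitesPerDir_descend F j 0) c) i₀ : ↥(Matrix.specialUnitaryGroup (Fin 2) ℂ)) : Matrix (Fin 2) (Fin 2) ℂ)‖ < ρ''}, fun _ _ _ => Iff.rfl⟩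
  obtain ⟨T', hT'⟩ : ∃ T' : PBond (F.P j) 0 → GaugeField (F.P (j + 1)) 0 ↥(Matrix.specialUnitaryGroup (Fin 2) ℂ) → Set ↥(Matrix.specialUnitaryGroup (Fin 2) ℂ), ∀ c U v, v ∈ T' c U ↔ ((∀ i, ¬ IsCentral (bondShift (sitesPerDir_descend F j 0) c) i → ‖((openHol U (bondShift (sitesPerDir_descend F j 0) c) i : ↥(Matrix.specialUnitaryGroup (Fin 2) ℂ)) : Matrix (Fin 2) (Fin 2) ℂ) - ((openHol U (bondShift (sitesPerDir_descend F j 0) c) i₀ : ↥(Matrix.specialUnitaryGroup (Fin 2) ℂ)) : Matrix (Fin 2) (Fin 2) ℂ)‖ < s) ∧ ‖((v : ↥(Matrix.specialUnitaryGroup (Fin 2) ℂ)) : Matrix (Fin 2) (Fin 2) ℂ) - ((openHol U (bondShift (sitesPerDir_descend F j 0) c) i₀ : ↥(Matrix.specialUnitaryGroup (Fin 2) ℂ)) : Matrix (Fin 2) (Fin 2) ℂ)‖ < ρ'' / 2) :=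
    ⟨fun c U => {v | (∀ i, ¬ IsCentral (bondShift (sitesPerDir_descend F j 0) c) i → ‖((openHol U (bondShift (sitesPerDir_descend F j 0) c) i : ↥(Matrix.specialUnitaryGroup (Fin 2) ℂ)) : Matrix (Fin 2) (Fin 2) ℂ) - ((openHol U (bondShift (sitesPerDir_descend F j 0) c) i₀ : ↥(Matrix.specialUnitaryGroup (Fin 2) ℂ)) : Matrix (Fin 2) (Fin 2) ℂ)‖ < s) ∧ ‖((v : ↥(Matrix.specialUnitaryGroup (Fin 2) ℂ)) : Matrix (Fin 2) (Fin 2) ℂ) - ((openHol U (bondShift (sitesPerDir_descend F j 0) c) i₀ : ↥(Matrix.specialUnitaryGroup (Fin 2) ℂ)) : Matrix (Fin 2) (Fin 2) ℂ)‖ < ρ'' / 2}, fun _ _ _ => Iff.rfl⟩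
  obtain ⟨θ, hθ⟩ : ∃ θ : PBond (F.P j) 0 → GaugeField (F.P (j + 1)) 0 ↥(Matrix.specialUnitaryGroup (Fin 2) ℂ) → ↥(Matrix.specialUnitaryGroup (Fin 2) ℂ) → ↥(Matrix.specialUnitaryGroup (Fin 2) ℂ), ∀ c U v,
      θ c U v = if v ∈ T c U then (pre U (bondShift (sitesPerDir_descend F j 0) c))⁻¹ * θ₀ c (openHol U (bondShift (sitesPerDir_descend F j 0) c)) v * (post U (bondShift (sitesPerDir_descend F j 0) c))⁻¹ else 1 :=
    ⟨fun c U v => if v ∈ T c U then (pre U (bondShift (sitesPerDir_descend F j 0) c))⁻¹ * θ₀ c (openHol U (bondShift (sitesPerDir_descend F j 0) c)) v * (post U (bondShift (sitesPerDir_descend F j 0) c))⁻¹ else 1, fun _ _ _ => rfl⟩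
  have hTset : ∀ c U, T c U = {v | (∀ i, ¬ IsCentral (bondShift (sitesPerDir_descend F j 0) c) i → ‖((openHol U (bondShift (sitesPerDir_descend F j 0) c) i : ↥(Matrix.specialUnitaryGroup (Fin 2) ℂ)) : Matrix (Fin 2) (Fin 2) ℂ) - ((openHol U (bondShift (sitesPerDir_descend F j 0) c) i₀ : ↥(Matrix.specialUnitaryGroup (Fin 2) ℂ)) : Matrix (Fin 2) (Fin 2) ℂ)‖ < s) ∧ ‖((v : ↥(Matrix.specialUnitaryGroup (Fin 2) ℂ)) : Matrix (Fin 2) (Fin 2) ℂ) - ((openHol U (bondShift (sitesPerDir_descend F j 0) c) i₀ : ↥(Matrix.specialUnitaryGroup (Fin 2) ℂ)) : Matrix (Fin 2) (Fin 2) ℂ)‖ < ρ''} := fun c U => Set.ext fun v => hT c U v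
  have hT'set : ∀ c U, T' c U = {v | (∀ i, ¬ IsCentral (bondShift (sitesPerDir_descend F j 0) c) i → ‖((openHol U (bondShift (sitesPerDir_descend F j 0) c) i : ↥(Matrix.specialUnitaryGroup (Fin 2) ℂ)) : Matrix (Fin 2) (Fin 2) ℂ) - ((openHol U (bondShift (sitesPerDir_descend F j 0) c) i₀ : ↥(Matrix.specialUnitaryGroup (Fin 2) ℂ)) : Matrix (Fin 2) (Fin 2) ℂ)‖ < s) ∧ ‖((v : ↥(Matrix.specialUnitaryGroup (Fin 2) ℂ)) : Matrix (Fin 2) (Fin 2) ℂ) - ((openHol U (bondShift (sitesPerDir_descend F j 0) c) i₀ : ↥(Matrix.specialUnitaryGroup (Fin 2) ℂ)) : Matrix (Fin 2) (Fin 2) ℂ)‖ < ρ'' / 2} := fun c U => Set.ext fun v => hT' c U v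
  have hTjoint : ∀ c, {p : GaugeField (F.P (j + 1)) 0 ↥(Matrix.specialUnitaryGroup (Fin 2) ℂ) × ↥(Matrix.specialUnitaryGroup (Fin 2) ℂ) | p.2 ∈ T c p.1} =
      {p | (∀ i, ¬ IsCentral (bondShift (sitesPerDir_descend F j 0) c) i → ‖((openHol p.1 (bondShift (sitesPerDir_descend F j 0) c) i : ↥(Matrix.specialUnitaryGroup (Fin 2) ℂ)) : Matrix (Fin 2) (Fin 2) ℂ) - ((openHol p.1 (bondShift (sitesPerDir_descend F j 0) c) i₀ : ↥(Matrix.specialUnitaryGroup (Fin 2) ℂ)) : Matrix (Fin 2) (Fin 2) ℂ)‖ < s) ∧ ‖((p.2 : ↥(Matrix.specialUnitaryGroup (Fin 2) ℂ)) : Matrix (Fin 2) (Fin 2) ℂ) - ((openHol p.1 (bondShift (sitesPerDir_descend F j 0) c) i₀ : ↥(Matrix.specialUnitaryGroup (Fin 2) ℂ)) : Matrix (Fin 2) (Fin 2) ℂ)‖ < ρ''} :=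
    fun c => Set.ext fun p => hT c p.1 p.2
  have hT'joint : ∀ c, {p : GaugeField (F.P (j + 1)) 0 ↥(Matrix.specialUnitaryGroup (Fin 2) ℂ) × ↥(Matrix.specialUnitaryGroup (Fin 2) ℂ) | p.2 ∈ T' c p.1} =
      {p | (∀ i, ¬ IsCentral (bondShift (sitesPerDir_descend F j 0) c) i → ‖((openHol p.1 (bondShift (sitesPerDir_descend F j 0) c) i : ↥(Matrix.specialUnitaryGroup (Fin 2) ℂ)) : Matrix (Fin 2) (Fin 2) ℂ) - ((openHol p.1 (bondShift (sitesPerDir_descend F j 0) c) i₀ : ↥(Matrix.specialUnitaryGroup (Fin 2) ℂ)) : Matrix (Fin 2) (Fin 2) ℂ)‖ < s) ∧ ‖((p.2 : ↥(Matrix.specialUnitaryGroup (Fin 2) ℂ)) : Matrix (Fin 2) (Fin 2) ℂ) - ((openHol p.1 (bondShift (sitesPerDir_descend F j 0) c) i₀ : ↥(Matrix.specialUnitaryGroup (Fin 2) ℂ)) : Matrix (Fin 2) (Fin 2) ℂ)‖ < ρ'' / 2} :=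
    fun c => Set.ext fun p => hT' c p.1 p.2
  -- the points of `T c U` are Stage-1 inputs
  have hmaps : ∀ (c : PBond (F.P j) 0) (U : GaugeField (F.P (j + 1)) 0 ↥(Matrix.specialUnitaryGroup (Fin 2) ℂ)) (v : ↥(Matrix.specialUnitaryGroup (Fin 2) ℂ)), v ∈ T c U →
      (openHol U (bondShift (sitesPerDir_descend F j 0) c), v) ∈ {q : (Idx (F.P (j + 1)) → ↥(Matrix.specialUnitaryGroup (Fin 2) ℂ)) × ↥(Matrix.specialUnitaryGroup (Fin 2) ℂ) |
          (∀ i, ¬ IsCentral (bondShift (sitesPerDir_descend F j 0) c) i → ‖((q.1 i : ↥(Matrix.specialUnitaryGroup (Fin 2) ℂ)) : Matrix (Fin 2) (Fin 2) ℂ) - ((q.1 i₀ : ↥(Matrix.specialUnitaryGroup (Fin 2) ℂ)) : Matrix (Fin 2) (Fin 2) ℂ)‖ ≤ s) ∧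
          ‖((q.2 : ↥(Matrix.specialUnitaryGroup (Fin 2) ℂ)) : Matrix (Fin 2) (Fin 2) ℂ) - ((q.1 i₀ : ↥(Matrix.specialUnitaryGroup (Fin 2) ℂ)) : Matrix (Fin 2) (Fin 2) ℂ)‖ ≤
            ρ - (((Finset.univ.filter fun i => ¬ IsCentral (bondShift (sitesPerDir_descend F j 0) c) i).card : ℝ) / (Fintype.card (Idx (F.P (j + 1))) : ℝ) * (s + ρ) +
              36 * (s + ρ) ^ 2)} :=
    fun c U v hv => ⟨fun i hi => ((hT c U v).1 hv |>.1 i hi).le, ((hT c U v).1 hv).2.le.trans (hρ'c c)⟩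
  -- (hright)
  have hright : ∀ (c : PBond (F.P j) 0) (U : GaugeField (F.P (j + 1)) 0 ↥(Matrix.specialUnitaryGroup (Fin 2) ℂ)), ∀ v ∈ T c U, descend F ℰp j (update U (centralBond (bondShift (sitesPerDir_descend F j 0) c)) (θ c U v)) c = v := by
    intro c U v hv
    obtain ⟨hgood, hball⟩ := (hT c U v).1 hv
    have hgood' : ∀ i, ¬ IsCentral (bondShift (sitesPerDir_descend F j 0) c) i → ‖((openHol U (bondShift (sitesPerDir_descend F j 0) c) i : ↥(Matrix.specialUnitaryGroup (Fin 2) ℂ)) : Matrix (Fin 2) (Fin 2) ℂ) - ((openHol U (bondShift (sitesPerDir_descend F j 0) c) i₀ : ↥(Matrix.specialUnitaryGroup (Fin 2) ℂ)) : Matrix (Fin 2) (Fin 2) ℂ)‖ ≤ s := fun i hi => (hgood i hi).le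
    obtain ⟨hW, hK⟩ := hθ₁ c (openHol U (bondShift (sitesPerDir_descend F j 0) c)) v hgood' (hball.le.trans (hρ'c c))
    have harg : pre U (bondShift (sitesPerDir_descend F j 0) c) * ((pre U (bondShift (sitesPerDir_descend F j 0) c))⁻¹ * θ₀ c (openHol U (bondShift (sitesPerDir_descend F j 0) c)) v * (post U (bondShift (sitesPerDir_descend F j 0) c))⁻¹) * post U (bondShift (sitesPerDir_descend F j 0) c) =
        θ₀ c (openHol U (bondShift (sitesPerDir_descend F j 0) c)) v := by group
    have hfam := fam_of_good_of_ball (IsCentral (bondShift (sitesPerDir_descend F j 0) c)) (fun i => ((openHol U (bondShift (sitesPerDir_descend F j 0) c) i : ↥(Matrix.specialUnitaryGroup (Fin 2) ℂ)) : Matrix (Fin 2) (Fin 2) ℂ)) i₀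
      ((θ₀ c (openHol U (bondShift (sitesPerDir_descend F j 0) c)) v : ↥(Matrix.specialUnitaryGroup (Fin 2) ℂ)) : Matrix (Fin 2) (Fin 2) ℂ) hd0.le hgood' hW
    rw [hθ, if_pos hv, descend_update_private_eq F j U c _ hrδ (fun i hi => by rw [harg]; exact hfam i hi)]
    simp only [harg]
    exact hK
  -- (REG) for the Stage-1 branch, jointly
  have hV : ∀ c : PBond (F.P j) 0, Continuous fun U : GaugeField (F.P (j + 1)) 0 ↥(Matrix.specialUnitaryGroup (Fin 2) ℂ) => openHol U (bondShift (sitesPerDir_descend F j 0) c) :=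
    fun c => continuous_pi fun i => (continuous_openHol_pre_post (bondShift (sitesPerDir_descend F j 0) c) i).1
  have hregb : ∀ c : PBond (F.P j) 0, ContinuousOn (fun p : GaugeField (F.P (j + 1)) 0 ↥(Matrix.specialUnitaryGroup (Fin 2) ℂ) × ↥(Matrix.specialUnitaryGroup (Fin 2) ℂ) =>
      (pre p.1 (bondShift (sitesPerDir_descend F j 0) c))⁻¹ * θ₀ c (openHol p.1 (bondShift (sitesPerDir_descend F j 0) c)) p.2 * (post p.1 (bondShift (sitesPerDir_descend F j 0) c))⁻¹) {p | p.2 ∈ T c p.1} := by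
    intro c
    have hθc : ContinuousOn (fun p : GaugeField (F.P (j + 1)) 0 ↥(Matrix.specialUnitaryGroup (Fin 2) ℂ) × ↥(Matrix.specialUnitaryGroup (Fin 2) ℂ) => θ₀ c (openHol p.1 (bondShift (sitesPerDir_descend F j 0) c)) p.2) {p | p.2 ∈ T c p.1} :=
      (hθ₃ c).comp (((hV c).comp continuous_fst).prodMk continuous_snd).continuousOn fun p hp => hmaps c p.1 p.2 hp
    exact ((((continuous_openHol_pre_post (bondShift (sitesPerDir_descend F j 0) c) i₀).2.1.comp continuous_fst).inv.continuousOn.mul hθc).mul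
      ((continuous_openHol_pre_post (bondShift (sitesPerDir_descend F j 0) c) i₀).2.2.comp continuous_fst).inv.continuousOn)
  have hreg : ∀ c : PBond (F.P j) 0, ContinuousOn (fun p : GaugeField (F.P (j + 1)) 0 ↥(Matrix.specialUnitaryGroup (Fin 2) ℂ) × ↥(Matrix.specialUnitaryGroup (Fin 2) ℂ) => θ c p.1 p.2) {p | p.2 ∈ T c p.1} :=
    fun c => (hregb c).congr fun p hp => by simp only [hθ, if_pos (show p.2 ∈ T c p.1 from hp)]
  refine ⟨T, T', θ, fun c U => ?_, fun c => ?_, fun c U => ?_, hright, hreg, fun c U => ?_, ?_, ?_, fun c => ?_, fun c => ?_, fun c => ?_,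
    fun c U U' hU' => ?_, fun c U v hv => ?_, fun c U g hg hgT => ?_⟩
  · rw [hTset]; exact isOpen_goodBall (bondShift (sitesPerDir_descend F j 0) c) i₀ s ρ'' U
  · rw [hTjoint]; exact isOpen_goodBall_joint (bondShift (sitesPerDir_descend F j 0) c) i₀ s ρ''
  · rw [hTset, hT'set]; exact closure_goodBall_half_subset (bondShift (sitesPerDir_descend F j 0) c) i₀ s hρ'' U
  · -- (REG) sectionwise
    exact (hreg c).comp (Continuous.prodMk_right U).continuousOn fun v hv => hv
  · -- (SOL)
    intro U hU c
    have hsg := small_is_good F j ha hU hta c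
    have hgood : ∀ i, ¬ IsCentral (bondShift (sitesPerDir_descend F j 0) c) i → ‖((openHol U (bondShift (sitesPerDir_descend F j 0) c) i : ↥(Matrix.specialUnitaryGroup (Fin 2) ℂ)) : Matrix (Fin 2) (Fin 2) ℂ) - ((openHol U (bondShift (sitesPerDir_descend F j 0) c) i₀ : ↥(Matrix.specialUnitaryGroup (Fin 2) ℂ)) : Matrix (Fin 2) (Fin 2) ℂ)‖ < s := fun i _ => (hsg i i₀).1.trans_lt h2t
    have hdesc₀ := (hsg i₀ i₀).2.2
    have hT'mem : descend F ℰp j U c ∈ T' c U := (hT' c U _).2 ⟨hgood, by linarith⟩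
    have hTmem : descend F ℰp j U c ∈ T c U := (hT c U _).2 ⟨hgood, by linarith⟩
    refine ⟨hT'mem, ?_⟩
    -- the field's own argument is `axialAvg = pre·U(β c)·post`, within `t ≤ ρ` of the centre; uniqueness of the preimage
    have hK := descend_eq_avg_mul_axialAvg F j ha hU hta c
    have hax : ‖((axialAvg U (bondShift (sitesPerDir_descend F j 0) c) : ↥(Matrix.specialUnitaryGroup (Fin 2) ℂ)) : Matrix (Fin 2) (Fin 2) ℂ) - ((openHol U (bondShift (sitesPerDir_descend F j 0) c) i₀ : ↥(Matrix.specialUnitaryGroup (Fin 2) ℂ)) : Matrix (Fin 2) (Fin 2) ℂ)‖ ≤ ρ := by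
      rw [norm_sub_rev]; exact ((hsg i₀ i₀).2.1).trans htρ
    have hpt : ‖((descend F ℰp j U c : ↥(Matrix.specialUnitaryGroup (Fin 2) ℂ)) : Matrix (Fin 2) (Fin 2) ℂ) - ((openHol U (bondShift (sitesPerDir_descend F j 0) c) i₀ : ↥(Matrix.specialUnitaryGroup (Fin 2) ℂ)) : Matrix (Fin 2) (Fin 2) ℂ)‖ ≤
        ρ - (((Finset.univ.filter fun i => ¬ IsCentral (bondShift (sitesPerDir_descend F j 0) c) i).card : ℝ) / (Fintype.card (Idx (F.P (j + 1))) : ℝ) * (s + ρ) +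
          36 * (s + ρ) ^ 2) := hdesc₀.trans (le_trans (by linarith) (hρ'c c))
    rw [hK] at hpt
    have hleft := hθ₂ c (openHol U (bondShift (sitesPerDir_descend F j 0) c)) (axialAvg U (bondShift (sitesPerDir_descend F j 0) c)) (fun i hi => (hgood i hi).le) hax hpt
    have hleft' : θ₀ c (openHol U (bondShift (sitesPerDir_descend F j 0) c)) (descend F ℰp j U c) = axialAvg U (bondShift (sitesPerDir_descend F j 0) c) := by rw [hK]; exact hleft
    rw [hθ, if_pos hTmem, hleft', axialAvg_eq_pre_mul_mul_post U (bondShift (sitesPerDir_descend F j 0) c)]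
    group
  · -- (hmargin)
    intro U V hVT hsmall c
    have hΦV : descend F ℰp j (extend (fun c : PBond (F.P j) 0 => centralBond (bondShift (sitesPerDir_descend F j 0) c)) (fun c => θ c U (V c)) U) = V :=
      T4TriangularFibredChart.apply_triChart_eq_of_forall_mem T θ (A := descend F ℰp j) (isLocal_descend F j) (injective_private F j)
        hright hVT
    have hsg := small_is_good F j ha hsmall hta c i₀ i₀
    refine (hT' c U _).2 ⟨((hT c U _).1 (hVT c)).1, ?_⟩
    have h7 := hsg.2.2
    have e := (congrFun hΦV c).symm
    -- blindness of the centre, the chart field written at type `GaugeField (F.P (j+1)) 0 SU(2)`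
    have hB := openHol_congr_off_private F j U
      (extend (fun c' : PBond (F.P j) 0 => centralBond (bondShift (sitesPerDir_descend F j 0) c')) (fun c' => θ c' U (V c')) U) c i₀ (hi₀ c)
      fun _ hb => extend_apply' _ _ _ hb
    have h7' : ‖((V c : ↥(Matrix.specialUnitaryGroup (Fin 2) ℂ)) : Matrix (Fin 2) (Fin 2) ℂ) - ((openHol U (bondShift (sitesPerDir_descend F j 0) c) i₀ : ↥(Matrix.specialUnitaryGroup (Fin 2) ℂ)) : Matrix (Fin 2) (Fin 2) ℂ)‖ ≤ 7 * ((((((F.P (j + 1)).d + 2) * (F.P (j + 1)).L : ℕ) : ℝ) ^ 2 / 4) * a) :=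
      calc ‖((V c : ↥(Matrix.specialUnitaryGroup (Fin 2) ℂ)) : Matrix (Fin 2) (Fin 2) ℂ) - ((openHol U (bondShift (sitesPerDir_descend F j 0) c) i₀ : ↥(Matrix.specialUnitaryGroup (Fin 2) ℂ)) : Matrix (Fin 2) (Fin 2) ℂ)‖
          = ‖((descend F ℰp j (extend (fun c' : PBond (F.P j) 0 => centralBond (bondShift (sitesPerDir_descend F j 0) c')) (fun c' => θ c' U (V c')) U) c : ↥(Matrix.specialUnitaryGroup (Fin 2) ℂ)) : Matrix (Fin 2) (Fin 2) ℂ) -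
              ((openHol (P := F.P (j + 1)) (j := 0) (extend (fun c' : PBond (F.P j) 0 => centralBond (bondShift (sitesPerDir_descend F j 0) c')) (fun c' => θ c' U (V c')) U)
                (bondShift (sitesPerDir_descend F j 0) c) i₀ : ↥(Matrix.specialUnitaryGroup (Fin 2) ℂ)) : Matrix (Fin 2) (Fin 2) ℂ)‖ := by
            rw [hB]
            exact congrArg (fun W : ↥(Matrix.specialUnitaryGroup (Fin 2) ℂ) => ‖((W : ↥(Matrix.specialUnitaryGroup (Fin 2) ℂ)) : Matrix (Fin 2) (Fin 2) ℂ) - ((openHol U (bondShift (sitesPerDir_descend F j 0) c) i₀ : ↥(Matrix.specialUnitaryGroup (Fin 2) ℂ)) : Matrix (Fin 2) (Fin 2) ℂ)‖) e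
        _ ≤ 7 * ((((((F.P (j + 1)).d + 2) * (F.P (j + 1)).L : ℕ) : ℝ) ^ 2 / 4) * a) := h7
    linarith
  · rw [hTjoint]; exact (isOpen_goodBall_joint (bondShift (sitesPerDir_descend F j 0) c) i₀ s ρ'').measurableSet
  · rw [hT'joint]; exact (isOpen_goodBall_joint (bondShift (sitesPerDir_descend F j 0) c) i₀ s (ρ'' / 2)).measurableSet
  · -- (hθm): `θ c` is the piecewise of a function continuous on the open set `{p | p.2 ∈ T c p.1}` and the constant `1`
    have hS : MeasurableSet {p : GaugeField (F.P (j + 1)) 0 ↥(Matrix.specialUnitaryGroup (Fin 2) ℂ) × ↥(Matrix.specialUnitaryGroup (Fin 2) ℂ) | p.2 ∈ T c p.1} := by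
      rw [hTjoint]; exact (isOpen_goodBall_joint (bondShift (sitesPerDir_descend F j 0) c) i₀ s ρ'').measurableSet
    have hpw : (fun p : GaugeField (F.P (j + 1)) 0 ↥(Matrix.specialUnitaryGroup (Fin 2) ℂ) × ↥(Matrix.specialUnitaryGroup (Fin 2) ℂ) => θ c p.1 p.2) =
        {p : GaugeField (F.P (j + 1)) 0 ↥(Matrix.specialUnitaryGroup (Fin 2) ℂ) × ↥(Matrix.specialUnitaryGroup (Fin 2) ℂ) | p.2 ∈ T c p.1}.piecewise
          (fun p => (pre p.1 (bondShift (sitesPerDir_descend F j 0) c))⁻¹ * θ₀ c (openHol p.1 (bondShift (sitesPerDir_descend F j 0) c)) p.2 * (post p.1 (bondShift (sitesPerDir_descend F j 0) c))⁻¹) (fun _ => 1) := by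
      funext p
      by_cases hp : p.2 ∈ T c p.1
      · rw [Set.piecewise_eq_of_mem _ _ _ (show p ∈ {p : GaugeField (F.P (j + 1)) 0 ↥(Matrix.specialUnitaryGroup (Fin 2) ℂ) × ↥(Matrix.specialUnitaryGroup (Fin 2) ℂ) | p.2 ∈ T c p.1} from hp), hθ, if_pos hp]
      · rw [Set.piecewise_eq_of_notMem _ _ _ (show p ∉ {p : GaugeField (F.P (j + 1)) 0 ↥(Matrix.specialUnitaryGroup (Fin 2) ℂ) × ↥(Matrix.specialUnitaryGroup (Fin 2) ℂ) | p.2 ∈ T c p.1} from hp), hθ, if_neg hp]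
    rw [hpw]
    exact (hregb c).measurable_piecewise continuousOn_const hS
  · -- ⑫ BLINDNESS of `T`, `T′`, `θ` to every private coordinate (pointwise-agreement form)
    have hβi : Injective fun c' : PBond (F.P j) 0 => centralBond (bondShift (sitesPerDir_descend F j 0) c') := injective_private F j
    -- `U'` IS the resampling `extend β (U' ∘ β) U`
    have hU'eq : U' = extend (fun c' : PBond (F.P j) 0 => centralBond (bondShift (sitesPerDir_descend F j 0) c')) (fun c' => U' (centralBond (bondShift (sitesPerDir_descend F j 0) c'))) U := by
      funext b
      by_cases hb : ∃ c' : PBond (F.P j) 0, centralBond (bondShift (sitesPerDir_descend F j 0) c') = b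
      · obtain ⟨c', rfl⟩ := hb
        exact (hβi.extend_apply (fun c' => U' (centralBond (bondShift (sitesPerDir_descend F j 0) c'))) U c').symm
      · rw [extend_apply' _ _ _ hb]; exact hU' b hb
    have hoff : ∀ i, ¬ IsCentral (bondShift (sitesPerDir_descend F j 0) c) i → openHol U' (bondShift (sitesPerDir_descend F j 0) c) i = openHol U (bondShift (sitesPerDir_descend F j 0) c) i :=
      fun i hi => openHol_congr_off_private F j U U' c i hi hU'
    have hpre : pre U' (bondShift (sitesPerDir_descend F j 0) c) = pre U (bondShift (sitesPerDir_descend F j 0) c) := by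
      rw [hU'eq]
      exact BlockAveragingCentralBlind.apply_extend_eq_of_forall_update (Q := fun V : GaugeField (F.P (j + 1)) 0 ↥(Matrix.specialUnitaryGroup (Fin 2) ℂ) => pre V (bondShift (sitesPerDir_descend F j 0) c)) hβi
        (fun V c' x => BlockAveragingCentralBlind.pre_update_centralBond_any (level_ok F j) V (bondShift (sitesPerDir_descend F j 0) c) (bondShift (sitesPerDir_descend F j 0) c') x) U _
    have hpost : post U' (bondShift (sitesPerDir_descend F j 0) c) = post U (bondShift (sitesPerDir_descend F j 0) c) := by
      rw [hU'eq]
      exact BlockAveragingCentralBlind.apply_extend_eq_of_forall_update (Q := fun V : GaugeField (F.P (j + 1)) 0 ↥(Matrix.specialUnitaryGroup (Fin 2) ℂ) => post V (bondShift (sitesPerDir_descend F j 0) c)) hβi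
        (fun V c' x => BlockAveragingCentralBlind.post_update_centralBond_any (level_ok F j) V (bondShift (sitesPerDir_descend F j 0) c) (bondShift (sitesPerDir_descend F j 0) c') x) U _
    have hTU : T c U' = T c U := by
      ext v; rw [hT, hT, hoff i₀ (hi₀ c)]
      exact and_congr_left' (forall₂_congr fun i hi => by rw [hoff i hi])
    have hT'U : T' c U' = T' c U := by
      ext v; rw [hT', hT', hoff i₀ (hi₀ c)]
      exact and_congr_left' (forall₂_congr fun i hi => by rw [hoff i hi])
    refine ⟨hTU, hT'U, fun v => ?_⟩
    by_cases hv : v ∈ T c U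
    · have hv' : v ∈ T c U' := hTU ▸ hv
      obtain ⟨hgood, hball⟩ := (hT c U v).1 hv
      have hgood' : ∀ i, ¬ IsCentral (bondShift (sitesPerDir_descend F j 0) c) i → ‖((openHol U (bondShift (sitesPerDir_descend F j 0) c) i : ↥(Matrix.specialUnitaryGroup (Fin 2) ℂ)) : Matrix (Fin 2) (Fin 2) ℂ) - ((openHol U (bondShift (sitesPerDir_descend F j 0) c) i₀ : ↥(Matrix.specialUnitaryGroup (Fin 2) ℂ)) : Matrix (Fin 2) (Fin 2) ℂ)‖ ≤ s := fun i hi => (hgood i hi).le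
      have hgoodU' : ∀ i, ¬ IsCentral (bondShift (sitesPerDir_descend F j 0) c) i → ‖((openHol U' (bondShift (sitesPerDir_descend F j 0) c) i : ↥(Matrix.specialUnitaryGroup (Fin 2) ℂ)) : Matrix (Fin 2) (Fin 2) ℂ) - ((openHol U' (bondShift (sitesPerDir_descend F j 0) c) i₀ : ↥(Matrix.specialUnitaryGroup (Fin 2) ℂ)) : Matrix (Fin 2) (Fin 2) ℂ)‖ ≤ s := fun i hi => by
        rw [hoff i hi, hoff i₀ (hi₀ c)]; exact hgood' i hi
      -- the Stage-1 preimage does not read the central entries of the environment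
      obtain ⟨hW, hK⟩ := hθ₁ c (openHol U (bondShift (sitesPerDir_descend F j 0) c)) v hgood' (hball.le.trans (hρ'c c))
      have hfun : (fun i => if IsCentral (bondShift (sitesPerDir_descend F j 0) c) i then (1 : ↥(Matrix.specialUnitaryGroup (Fin 2) ℂ)) else openHol U' (bondShift (sitesPerDir_descend F j 0) c) i * (θ₀ c (openHol U (bondShift (sitesPerDir_descend F j 0) c)) v)⁻¹) =
          (fun i => if IsCentral (bondShift (sitesPerDir_descend F j 0) c) i then (1 : ↥(Matrix.specialUnitaryGroup (Fin 2) ℂ)) else openHol U (bondShift (sitesPerDir_descend F j 0) c) i * (θ₀ c (openHol U (bondShift (sitesPerDir_descend F j 0) c)) v)⁻¹) := by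
        funext i
        by_cases hi : IsCentral (bondShift (sitesPerDir_descend F j 0) c) i
        · rw [if_pos hi, if_pos hi]
        · rw [if_neg hi, if_neg hi, hoff i hi]
      have hW' : ‖((θ₀ c (openHol U (bondShift (sitesPerDir_descend F j 0) c)) v : ↥(Matrix.specialUnitaryGroup (Fin 2) ℂ)) : Matrix (Fin 2) (Fin 2) ℂ) - ((openHol U' (bondShift (sitesPerDir_descend F j 0) c) i₀ : ↥(Matrix.specialUnitaryGroup (Fin 2) ℂ)) : Matrix (Fin 2) (Fin 2) ℂ)‖ ≤ ρ := by rw [hoff i₀ (hi₀ c)]; exact hW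
      have hKU' : (expMeanLogSU (n := Fin 2)).avg (fun i => if IsCentral (bondShift (sitesPerDir_descend F j 0) c) i then (1 : ↥(Matrix.specialUnitaryGroup (Fin 2) ℂ)) else
          openHol U' (bondShift (sitesPerDir_descend F j 0) c) i * (θ₀ c (openHol U (bondShift (sitesPerDir_descend F j 0) c)) v)⁻¹) * θ₀ c (openHol U (bondShift (sitesPerDir_descend F j 0) c)) v = v := by
        rw [hfun]; exact hK
      have h3 : ‖(((expMeanLogSU (n := Fin 2)).avg (fun i => if IsCentral (bondShift (sitesPerDir_descend F j 0) c) i then (1 : ↥(Matrix.specialUnitaryGroup (Fin 2) ℂ)) else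
          openHol U' (bondShift (sitesPerDir_descend F j 0) c) i * (θ₀ c (openHol U (bondShift (sitesPerDir_descend F j 0) c)) v)⁻¹) * θ₀ c (openHol U (bondShift (sitesPerDir_descend F j 0) c)) v : ↥(Matrix.specialUnitaryGroup (Fin 2) ℂ)) : Matrix (Fin 2) (Fin 2) ℂ) - ((openHol U' (bondShift (sitesPerDir_descend F j 0) c) i₀ : ↥(Matrix.specialUnitaryGroup (Fin 2) ℂ)) : Matrix (Fin 2) (Fin 2) ℂ)‖ ≤
          ρ - (((Finset.univ.filter fun i => ¬ IsCentral (bondShift (sitesPerDir_descend F j 0) c) i).card : ℝ) / (Fintype.card (Idx (F.P (j + 1))) : ℝ) * (s + ρ) +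
            36 * (s + ρ) ^ 2) := by
        rw [hKU', hoff i₀ (hi₀ c)]; exact hball.le.trans (hρ'c c)
      have hleft := hθ₂ c (openHol U' (bondShift (sitesPerDir_descend F j 0) c)) (θ₀ c (openHol U (bondShift (sitesPerDir_descend F j 0) c)) v) hgoodU' hW' h3
      have hleft' : θ₀ c (openHol U' (bondShift (sitesPerDir_descend F j 0) c)) v = θ₀ c (openHol U (bondShift (sitesPerDir_descend F j 0) c)) v :=
        calc θ₀ c (openHol U' (bondShift (sitesPerDir_descend F j 0) c)) v
            = θ₀ c (openHol U' (bondShift (sitesPerDir_descend F j 0) c)) ((expMeanLogSU (n := Fin 2)).avg (fun i => if IsCentral (bondShift (sitesPerDir_descend F j 0) c) i then (1 : ↥(Matrix.specialUnitaryGroup (Fin 2) ℂ)) else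
                openHol U' (bondShift (sitesPerDir_descend F j 0) c) i * (θ₀ c (openHol U (bondShift (sitesPerDir_descend F j 0) c)) v)⁻¹) * θ₀ c (openHol U (bondShift (sitesPerDir_descend F j 0) c)) v) := by rw [hKU']
          _ = θ₀ c (openHol U (bondShift (sitesPerDir_descend F j 0) c)) v := hleft
      rw [hθ, hθ, if_pos hv', if_pos hv, hpre, hpost, hleft']
    · have hv' : v ∉ T c U' := hTU ▸ hv
      rw [hθ, hθ, if_neg hv', if_neg hv]
  · -- ⑬ the preimage lies in the `ρ`-ball and in the `(s+ρ+d₀)`-family window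
    obtain ⟨hgood, hball⟩ := (hT c U v).1 hv
    have hgood' : ∀ i, ¬ IsCentral (bondShift (sitesPerDir_descend F j 0) c) i → ‖((openHol U (bondShift (sitesPerDir_descend F j 0) c) i : ↥(Matrix.specialUnitaryGroup (Fin 2) ℂ)) : Matrix (Fin 2) (Fin 2) ℂ) - ((openHol U (bondShift (sitesPerDir_descend F j 0) c) i₀ : ↥(Matrix.specialUnitaryGroup (Fin 2) ℂ)) : Matrix (Fin 2) (Fin 2) ℂ)‖ ≤ s := fun i hi => (hgood i hi).le
    obtain ⟨hW, -⟩ := hθ₁ c (openHol U (bondShift (sitesPerDir_descend F j 0) c)) v hgood' (hball.le.trans (hρ'c c))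
    have harg : pre U (bondShift (sitesPerDir_descend F j 0) c) * θ c U v * post U (bondShift (sitesPerDir_descend F j 0) c) = θ₀ c (openHol U (bondShift (sitesPerDir_descend F j 0) c)) v := by rw [hθ, if_pos hv]; group
    rw [harg]
    exact ⟨hW, fam_of_good_of_ball (IsCentral (bondShift (sitesPerDir_descend F j 0) c)) (fun i => ((openHol U (bondShift (sitesPerDir_descend F j 0) c) i : ↥(Matrix.specialUnitaryGroup (Fin 2) ℂ)) : Matrix (Fin 2) (Fin 2) ℂ)) i₀ _ hd0.le hgood' hW⟩
  · -- ⑭ LEFT INVERSE: `θ ∘ K = id` on the `ρ`-ball part of the fibre over `T`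
    have hne : (T c U).Nonempty := ⟨_, hgT⟩
    obtain ⟨hgood, hballK⟩ := (hT c U _).1 hgT
    have hgood' : ∀ i, ¬ IsCentral (bondShift (sitesPerDir_descend F j 0) c) i → ‖((openHol U (bondShift (sitesPerDir_descend F j 0) c) i : ↥(Matrix.specialUnitaryGroup (Fin 2) ℂ)) : Matrix (Fin 2) (Fin 2) ℂ) - ((openHol U (bondShift (sitesPerDir_descend F j 0) c) i₀ : ↥(Matrix.specialUnitaryGroup (Fin 2) ℂ)) : Matrix (Fin 2) (Fin 2) ℂ)‖ ≤ s := fun i hi => (hgood i hi).le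
    have hfam := fam_of_good_of_ball (IsCentral (bondShift (sitesPerDir_descend F j 0) c)) (fun i => ((openHol U (bondShift (sitesPerDir_descend F j 0) c) i : ↥(Matrix.specialUnitaryGroup (Fin 2) ℂ)) : Matrix (Fin 2) (Fin 2) ℂ)) i₀ _ hd0.le hgood' hg
    have hK := descend_update_private_eq F j U c g hrδ hfam
    have hballK' := hballK
    rw [hK] at hballK'
    have hleft := hθ₂ c (openHol U (bondShift (sitesPerDir_descend F j 0) c)) (pre U (bondShift (sitesPerDir_descend F j 0) c) * g * post U (bondShift (sitesPerDir_descend F j 0) c)) hgood' hg (hballK'.le.trans (hρ'c c))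
    have hleft' : θ₀ c (openHol U (bondShift (sitesPerDir_descend F j 0) c)) (descend F ℰp j (update U (centralBond (bondShift (sitesPerDir_descend F j 0) c)) g) c) = pre U (bondShift (sitesPerDir_descend F j 0) c) * g * post U (bondShift (sitesPerDir_descend F j 0) c) := by
      rw [hK]; exact hleft
    rw [hθ, if_pos hgT, hleft']
    group

end Summit.QuantumFields.YangMills.Theorems.FluctuationComparisonRegPrIntLOrganTangentOneBondData

end
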